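import Summits.CriticalPhenomena.SAWScalingLimit.Theorems.BoundaryClosureR.Negative.NormaliserPin

/-!
# Negative knowledge on crux `HexObservableLimitR` (stmt-CriticalPhenomena-14003), part 1:
the floor edges `vEdge n` of the strip-profile body and its discrete hypotheses

Support for `PinnedInstance.lean` (a FULLY PINNED admissible instance of the repaired target on the
upper half unit disc `HD`).  Contents: the vertical boundary mid-edges
`vEdge n = {fj (2n) 0, fj (2n+1) (-1)}` of the floor of the body `Lam δ false` (midpoint `n + 1/2`,
`hexMidpoint_vEdge`; `vEdge 0 = bEdge`), the cell `nC r δ = ⌊r/δ⌋` with `|δ·nC - r| ≤ δ` (`abs_nC`) and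
the limit `δ·mid(vEdge (nC r δ)) → r` (`tendsto_smul_midpoint_vEdge`); boundary membership
(`vEdge_mem_boundary`), the straight row-`0` walks between `bEdge` and `vEdge n` in both directions
(`nonempty_saw_bEdge_vEdge`, `nonempty_saw_vEdge_bEdge`); the packaged discrete hypotheses of the
target for the body with BOTH pin-balls of radius `1/8` (`discrete_hyps`: the body is the exact
half-lattice `{row ≥ 0}` in every `ball p (1/8)`, `|p| ≤ 3/8`, by `mem_Lam_iff_of_ball`), exhaustion of
compacts (`exhaustion`) and flatness of `∂HD` at real points (`flat_at`).  Everything proved. [folklore]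
-/

noncomputable section

open Set Filter Topology Complex
open Literature.Probability.RandomPlanarGeometry
open UpperHalfPlane (upperHalfPlaneSet)
open Literature.Probability.LatticeModels Literature.Probability.RandomPlanarGeometry.SAW

namespace Summit.CriticalPhenomena.SAWScalingLimit.Theorems.HexObservableLimitR.Negative

open BoundaryClosure.Negative BoundaryClosureR.Negative

/-! ### The vertical floor edges `vEdge n` -/

/-- **The vertical boundary mid-edge below the up-face of cell `n` on row `0`**: between `fj (2n) 0`
(inside) and the down-face `fj (2n+1) (-1)` of row `-1` (outside); `vEdge 0 = bEdge`. [folklore] -/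
def vEdge (n : ℤ) : Sym2 HexVertex := s(fj (2 * n) 0, fj (2 * n + 1) (-1))

/-- `vEdge 0` is the normalisation edge `bEdge` of the corridor refutation. [folklore] -/
theorem vEdge_zero : vEdge 0 = bEdge := by
  unfold vEdge bEdge; norm_num

/-- The two faces of `vEdge n` are adjacent (a vertical edge of the honeycomb lattice). [folklore] -/
theorem adj_vEdge (n : ℤ) : hexGraph.Adj (fj (2 * n) 0) (fj (2 * n + 1) (-1)) := by
  simpa using adj_fj_down (show (2 * n) % 2 = 0 by omega) 0

/-- **The midpoint of `vEdge n` is the real number `n + 1/2`.** [folklore] -/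
theorem hexMidpoint_vEdge (n : ℤ) : hexMidpoint (vEdge n) = (((n : ℝ) + 1 / 2 : ℝ) : ℂ) := by
  unfold vEdge
  rw [hexMidpoint_mk]
  apply Complex.ext
  · simp only [Complex.add_re, Complex.div_ofNat_re, re_hexCenter_fj, Complex.ofReal_re]
    push_cast; ring
  · simp only [Complex.add_im, Complex.div_ofNat_im, im_hexCenter_fj, Complex.ofReal_im]
    rw [show (2 * n) % 2 = 0 by omega, show (2 * n + 1) % 2 = 1 by omega]
    push_cast; ring

/-- **The normalisation / root cell near the real point `r`**: `nC r δ = ⌊r/δ⌋`. [folklore] -/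
def nC (r δ : ℝ) : ℤ := ⌊r / δ⌋

/-- `|δ·nC - r| ≤ δ`. [folklore] -/
theorem abs_nC (r δ : ℝ) (hδ : 0 < δ) : |δ * nC r δ - r| ≤ δ := by
  have h1 : (nC r δ : ℝ) ≤ r / δ := Int.floor_le _
  have h2 : r / δ - 1 < (nC r δ : ℝ) := Int.sub_one_lt_floor _
  have e : δ * (r / δ) = r := mul_div_cancel₀ r hδ.ne'
  rw [abs_le]; constructor <;> nlinarith

/-- `nC r δ ≤ X = ⌈1/(2δ)⌉` for `r ≤ 1/2`. [folklore] -/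
theorem nC_le_Xc {r δ : ℝ} (hδ : 0 < δ) (hr : r ≤ 1 / 2) : nC r δ ≤ Xc δ := by
  have h1 : (nC r δ : ℝ) ≤ r / δ := Int.floor_le _
  have h2 := (Xc_bounds δ).1
  have h3 : r / δ ≤ 1 / (2 * δ) := by
    rw [div_le_div_iff₀ hδ (by positivity)]; nlinarith
  exact_mod_cast h1.trans (h3.trans h2)

/-- `1 ≤ nC r δ` once `δ ≤ r`. [folklore] -/
theorem one_le_nC {r δ : ℝ} (hδ : 0 < δ) (hr : δ ≤ r) : 1 ≤ nC r δ := by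
  have : (1 : ℝ) ≤ r / δ := by rw [le_div_iff₀ hδ]; linarith
  exact Int.le_floor.2 (by exact_mod_cast this)

/-- **The rescaled floor edge converges to the marked point** `p` when `|δ n δ - p| ≤ δ`. [folklore] -/
theorem tendsto_smul_midpoint_vEdge {n : ℝ → ℤ} {p : ℝ}
    (h : ∀ δ : ℝ, 0 < δ → |δ * n δ - p| ≤ δ) :
    Filter.Tendsto (fun δ : ℝ => (δ : ℂ) * hexMidpoint (vEdge (n δ))) (nhdsWithin 0 (Set.Ioi 0))
      (nhds ((p : ℝ) : ℂ)) := by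
  have e : (fun δ : ℝ => (δ : ℂ) * hexMidpoint (vEdge (n δ))) =
      fun δ : ℝ => ((δ * ((n δ : ℝ) + 5 / 4) : ℝ) : ℂ) - ((δ * (3 / 4) : ℝ) : ℂ) := by
    funext δ; rw [hexMidpoint_vEdge]; push_cast; ring
  rw [e, show ((p : ℝ) : ℂ) = (p : ℂ) - ((0 : ℝ) : ℂ) by simp]
  refine Filter.Tendsto.sub ?_ ?_
  · exact (Complex.continuous_ofReal.tendsto _).comp (tendsto_mul_cell (n := fun δ => (n δ : ℝ)) h)
  · refine (Complex.continuous_ofReal.tendsto _).comp ?_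
    have h0 : Filter.Tendsto (fun δ : ℝ => δ) (nhdsWithin 0 (Set.Ioi 0)) (nhds 0) :=
      tendsto_nhdsWithin_of_tendsto_nhds Filter.tendsto_id
    simpa using h0.mul_const (3 / 4 : ℝ)

/-! ### The floor edges in the body `Lam δ false` -/

section Geometry

variable {δ : ℝ} (hδ : 0 < δ) (hδ' : δ ≤ 1 / 16)
include hδ hδ'

/-- The row-`0` faces `fj i 0`, `0 ≤ i ≤ 2X+1`, are vertices of the body. [folklore] -/
theorem fj_row_zero_mem_body {i : ℤ} (h0 : 0 ≤ i) (hi : i ≤ 2 * Xc δ + 1) : fj i 0 ∈ Lam δ false :=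
  fj_row_zero_mem hδ hδ' false h0 (by simpa [rootCell] using hi)

/-- Faces of row `-1` are not vertices. [folklore] -/
theorem fj_neg_one_not_mem (j : ℤ) : fj j (-1) ∉ Lam δ false := by
  have := compl_of_neg hδ hδ' false (j := j) (show (-1 : ℤ) < 0 by norm_num)
  rwa [Set.mem_compl_iff, Finset.mem_coe] at this

/-- **`vEdge n` is a boundary mid-edge of the body** for `0 ≤ n ≤ X`. [folklore] -/
theorem vEdge_mem_boundary {n : ℤ} (h0 : 0 ≤ n) (hn : n ≤ Xc δ) :
    vEdge n ∈ hexDomainBoundary (Lam δ false) :=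
  ⟨(SimpleGraph.mem_edgeSet hexGraph).2 (adj_vEdge n), fj (2 * n + 1) (-1), fj (2 * n) 0, Sym2.eq_swap,
    fj_row_zero_mem_body hδ hδ' (by omega) (by omega), fj_neg_one_not_mem hδ hδ' _⟩

/-- **The straight walk from `bEdge` to `vEdge n`** (`1 ≤ n ≤ X`): `fj 0 0 → fj 1 0 → ⋯ → fj (2n) 0`,
exiting downwards. [folklore] -/
theorem nonempty_saw_bEdge_vEdge {n : ℤ} (h1 : 1 ≤ n) (hn : n ≤ Xc δ) :
    Nonempty (HexMidEdgeSAW (Lam δ false) bEdge (vEdge n)) := by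
  obtain ⟨N, hN⟩ : ∃ N : ℕ, (N : ℤ) = n := ⟨n.toNat, by omega⟩
  have hΛ : ∀ i : ℕ, i ≤ 2 * N → fj i 0 ∈ Lam δ false := fun i hi =>
    fj_row_zero_mem_body hδ hδ' (by omega) (by omega)
  set L := (rowWalk (2 * N)).reverse with hL
  have hmemL : ∀ v ∈ L, ∃ i : ℕ, i ≤ 2 * N ∧ v = fj i 0 := fun v hv =>
    mem_rowWalk.1 (List.mem_reverse.1 hv)
  have hmem : ∀ e ∈ List.zipWith (fun u w => s(u, w)) L L.tail,
      ∀ c ∈ e, ∃ i : ℕ, i ≤ 2 * N ∧ c = fj i 0 := fun e he c hc =>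
    hmemL c (forall_mem_of_mem_edges _ e he c hc)
  have hvL : vEdge n ∉ List.zipWith (fun u w => s(u, w)) L L.tail := by
    intro h
    obtain ⟨i, hi, he⟩ := hmem _ h (fj (2 * n + 1) (-1)) (by unfold vEdge; exact Sym2.mem_mk_right _ _)
    have := (fj_inj.1 he).2; omega
  have hbL : bEdge ∉ List.zipWith (fun u w => s(u, w)) L L.tail := by
    intro he
    obtain ⟨i, hi, he'⟩ := hmem _ he (fj 1 (-1)) (by exact Sym2.mem_mk_right _ _)
    have := (fj_inj.1 he').2; omega
  have hvb : vEdge n ≠ bEdge := by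
    intro h
    have : fj (2 * n) 0 ∈ bEdge := by rw [← h]; unfold vEdge; exact Sym2.mem_mk_left _ _
    unfold bEdge at this
    rcases Sym2.mem_iff.1 this with h1' | h1'
    · have := (fj_inj.1 h1').1; omega
    · have := (fj_inj.1 h1').2; omega
  have hadj : hexGraph.Adj (fj 0 0) (fj 1 (-1)) := by
    simpa using adj_fj_down (show (0:ℤ) % 2 = 0 by norm_num) 0
  have hLne : L ≠ [] := by rw [hL]; simpa using rowWalk_ne_nil _
  refine ⟨{ verts := L
            subset := fun v hv => ?_
            nodup := List.nodup_reverse.2 (nodup_rowWalk _)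
            isChain := List.isChain_reverse.2 ((isChain_rowWalk _).imp fun a b h => h.symm)
            head_mem := fun v hv => ?_
            getLast_mem := fun v hv => ?_
            eq_of_nil := fun h => (hLne h).elim
            edges_nodup := fun _ => ?_
            fst_mem := ⟨(SimpleGraph.mem_edgeSet hexGraph).2 hadj, fj 0 0, Sym2.mem_mk_left _ _,
              by exact_mod_cast hΛ 0 (by omega)⟩ }⟩
  · obtain ⟨i, hi, rfl⟩ := hmemL v hv
    exact hΛ i hi
  · rw [hL, List.head?_reverse, getLast?_rowWalk, Option.some_inj] at hv
    subst hv
    exact Sym2.mem_mk_left _ _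
  · rw [hL, List.getLast?_reverse, head?_rowWalk, Option.some_inj] at hv
    subst hv
    unfold vEdge
    rw [← hN]; push_cast
    exact Sym2.mem_mk_left _ _
  · have hLn := edges_nodup (List.nodup_reverse.2 (nodup_rowWalk (2 * N)))
    rw [← hL] at hLn
    refine List.nodup_append.2 ⟨List.nodup_cons.2 ⟨hbL, hLn⟩, List.nodup_singleton _, ?_⟩
    intro e he f hf
    rw [List.mem_singleton] at hf
    subst hf
    rcases List.mem_cons.1 he with rfl | he
    · exact hvb.symm
    · rintro rfl; exact hvL he

/-- **The straight walk from `vEdge n` to `bEdge`** (`1 ≤ n ≤ X`): `fj (2n) 0 → ⋯ → fj 1 0 → fj 0 0`,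
exiting downwards. [folklore] -/
theorem nonempty_saw_vEdge_bEdge {n : ℤ} (h1 : 1 ≤ n) (hn : n ≤ Xc δ) :
    Nonempty (HexMidEdgeSAW (Lam δ false) (vEdge n) bEdge) := by
  obtain ⟨N, hN⟩ : ∃ N : ℕ, (N : ℤ) = n := ⟨n.toNat, by omega⟩
  have hΛ : ∀ i : ℕ, i ≤ 2 * N → fj i 0 ∈ Lam δ false := fun i hi =>
    fj_row_zero_mem_body hδ hδ' (by omega) (by omega)
  set L := rowWalk (2 * N) with hL
  have hmemL : ∀ v ∈ L, ∃ i : ℕ, i ≤ 2 * N ∧ v = fj i 0 := fun v hv => mem_rowWalk.1 hv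
  have hmem : ∀ e ∈ List.zipWith (fun u w => s(u, w)) L L.tail,
      ∀ c ∈ e, ∃ i : ℕ, i ≤ 2 * N ∧ c = fj i 0 := fun e he c hc =>
    hmemL c (forall_mem_of_mem_edges _ e he c hc)
  have hvL : vEdge n ∉ List.zipWith (fun u w => s(u, w)) L L.tail := by
    intro h
    obtain ⟨i, hi, he⟩ := hmem _ h (fj (2 * n + 1) (-1)) (by unfold vEdge; exact Sym2.mem_mk_right _ _)
    have := (fj_inj.1 he).2; omega
  have hbL : bEdge ∉ List.zipWith (fun u w => s(u, w)) L L.tail := by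
    intro he
    obtain ⟨i, hi, he'⟩ := hmem _ he (fj 1 (-1)) (by exact Sym2.mem_mk_right _ _)
    have := (fj_inj.1 he').2; omega
  have hvb : vEdge n ≠ bEdge := by
    intro h
    have : fj (2 * n) 0 ∈ bEdge := by rw [← h]; unfold vEdge; exact Sym2.mem_mk_left _ _
    unfold bEdge at this
    rcases Sym2.mem_iff.1 this with h1' | h1'
    · have := (fj_inj.1 h1').1; omega
    · have := (fj_inj.1 h1').2; omega
  have hLne : L ≠ [] := by rw [hL]; exact rowWalk_ne_nil _
  refine ⟨{ verts := L
            subset := fun v hv => ?_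
            nodup := nodup_rowWalk _
            isChain := isChain_rowWalk _
            head_mem := fun v hv => ?_
            getLast_mem := fun v hv => ?_
            eq_of_nil := fun h => (hLne h).elim
            edges_nodup := fun _ => ?_
            fst_mem := ⟨(SimpleGraph.mem_edgeSet hexGraph).2 (adj_vEdge n), fj (2 * n) 0,
              by unfold vEdge; exact Sym2.mem_mk_left _ _, ?_⟩ }⟩
  · obtain ⟨i, hi, rfl⟩ := hmemL v hv
    exact hΛ i hi
  · rw [hL, head?_rowWalk, Option.some_inj] at hv
    subst hv
    unfold vEdge
    rw [← hN]; push_cast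
    exact Sym2.mem_mk_left _ _
  · rw [hL, getLast?_rowWalk, Option.some_inj] at hv
    subst hv
    exact Sym2.mem_mk_left _ _
  · have hLn := edges_nodup (nodup_rowWalk (2 * N))
    rw [← hL] at hLn
    refine List.nodup_append.2 ⟨List.nodup_cons.2 ⟨hvL, hLn⟩, List.nodup_singleton _, ?_⟩
    intro e he f hf
    rw [List.mem_singleton] at hf
    subst hf
    rcases List.mem_cons.1 he with rfl | he
    · exact hvb
    · rintro rfl; exact hbL he
  · have := hΛ (2 * N) le_rfl
    rw [← hN]; exact_mod_cast this

omit hδ hδ' in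
/-- A real ball `ball p ρ` with `|p| + ρ ≤ 1/2` lies in `ball 0 (1/2)`. [folklore] -/
theorem ball_real_subset {p ρ : ℝ} (h : |p| + ρ ≤ 1 / 2) :
    Metric.ball ((p : ℝ) : ℂ) ρ ⊆ Metric.ball (0 : ℂ) (1 / 2) := by
  intro z hz
  rw [Metric.mem_ball, dist_zero_right]
  rw [Metric.mem_ball, dist_eq_norm] at hz
  calc ‖z‖ = ‖(z - p) + p‖ := by ring_nf
    _ ≤ ‖z - (p : ℂ)‖ + ‖(p : ℂ)‖ := norm_add_le _ _
    _ < ρ + |p| := by rw [Complex.norm_real, Real.norm_eq_abs]; linarith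
    _ ≤ 1 / 2 := by linarith

/-- **The discrete hypotheses of the target hold for the body**, rooted/normalised at `bEdge` and
`vEdge (nC r δ)` (either way round), with both pin-balls of radius `1/8` about `0` and `r ≤ 3/8`,
for `0 < δ ≤ min (1/16) r`. [folklore] -/
theorem discrete_hyps {r : ℝ} (hr : 0 < r ∧ r ≤ 3 / 8) (hδr : δ ≤ r) :
    hexDomainSimplyConnected (Lam δ false) ∧
    bEdge ∈ hexDomainBoundary (Lam δ false) ∧
    vEdge (nC r δ) ∈ hexDomainBoundary (Lam δ false) ∧
    Nonempty (HexMidEdgeSAW (Lam δ false) bEdge (vEdge (nC r δ))) ∧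
    Nonempty (HexMidEdgeSAW (Lam δ false) (vEdge (nC r δ)) bEdge) ∧
    (hexGraph.induce ((Lam δ false : Finset HexVertex) : Set HexVertex)).Preconnected ∧
    (∀ v ∈ Lam δ false, (δ : ℂ) * hexCenter v ∈ HD) ∧
    (∀ (p : ℝ), |p| + 1 / 8 ≤ 1 / 2 → ∀ v : HexVertex,
      (δ : ℂ) * hexCenter v ∈ Metric.ball ((p : ℝ) : ℂ) (1 / 8) → (v ∈ Lam δ false ↔ 0 ≤ v.1 1)) := by
  have h1 := one_le_nC hδ hδr
  have hX := nC_le_Xc hδ (by linarith [hr.2] : r ≤ 1 / 2)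
  exact ⟨simplyConnected_Lam hδ hδ' false, bEdge_mem_boundary hδ hδ' false,
    vEdge_mem_boundary hδ hδ' (by omega) hX, nonempty_saw_bEdge_vEdge hδ hδ' h1 hX,
    nonempty_saw_vEdge_bEdge hδ hδ' h1 hX, preconnected_Lam hδ hδ' false,
    fun v hv => smul_center_mem_HD hδ hδ' false hv,
    fun p hp v hv => mem_Lam_iff_of_ball hδ hδ' false (ball_real_subset hp hv)⟩

end Geometry

/-- **Exhaustion of compacts by the body.** [folklore] -/
theorem exhaustion (K : Set ℂ) (hK : IsCompact K) (hKD : K ⊆ HD) :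
    ∀ᶠ δ : ℝ in 𝓝[>] 0, ∀ v : HexVertex, (δ : ℂ) * hexCenter v ∈ K → v ∈ Lam δ false := by
  obtain ⟨ε, hε, hε1, hthick⟩ := exists_thick_of_isCompact hK hKD
  filter_upwards [eventually_small (by positivity : 0 < ε / 4)] with δ hδ v hv
  obtain ⟨hδ, hδ', hδε⟩ := hδ
  obtain ⟨hn, hi⟩ := hthick _ hv
  exact mem_Lam_of_thick hδ hδ' false hδε hn hi

/-- Flatness of the half-disc at a real point `p` with `|p| ≤ 7/8`, radius `1/8`. [folklore] -/
theorem flat_at {p : ℝ} (hp : |p| + 1 / 8 ≤ 1) :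
    HD ∩ Metric.ball ((p : ℝ) : ℂ) (1 / 8) = {z : ℂ | ((p : ℝ) : ℂ).im < z.im} ∩ Metric.ball ((p : ℝ) : ℂ) (1 / 8) :=
  HD_inter_ball_real hp

end Summit.CriticalPhenomena.SAWScalingLimit.Theorems.HexObservableLimitR.Negative
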